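import Mathlib

/-!
# EriceRemainderEnclosureHistoryAutonomyComparisonAgeCompositionAdaptiveCascade — (E101a) route (N), first order: THE ADAPTIVE RESIDUAL CASCADE (pure).
# The cluster cascade (E95c) `renewal_nonneg_cluster_cascade` hands ONE overshoot constant `κ` down through all levels and pays for it with ONE
# separation `R₀ ≈ (κ + 4s(1+κ))∕((1 − s(1+κ))κ) ≈ 61` between EVERY pair of consecutive levels, whatever their masses; (E96a) decouples only the
# youngest gap.  But the invariant of (E95c) is level-by-level: if the targets of every level `j' > j` are `≤ (1+κ_{j'})·B_{j'+1}` and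
# `hi_{j−1}·U_{j−1} ≤ κ_{j−1}·B_j`, then the targets of level `j−1` are `≤ (1+κ_{j−1})·B_j`, with the overshoots `κ_j` FREE PER LEVEL (and per pin).
# The TOP level needs none (`κ_{r−1} = 0` is allowed: its targets are `≤ e_q ≤ e_m = B_r`), and the propagation one level down reads
#     `hi_{j−1}·(4x_j(1+κ_j) + κ_j) ≤ κ_{j−1}·(1 − x_j(1+κ_j))·lo_j`                                  (**the adaptive closure**, `x_j(1+κ_j) < 1`),
# the youngest level `x_0(1+κ_0) ≤ 1`.  THEN `0 ≤ ε ≤ e` — with NO uniform ratio: a light level (`x_j` small) needs `lo_j∕hi_{j−1}` barely above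
# `κ_j∕κ_{j−1}`, a heavy one below a top level needs `4x_j∕(κ_{j−1}(1 − x_j))` (`= 32` for `x_j = 0.6142`, `κ_{j−1} = 1∕5`: (E99g)'s last step), and
# the masses at the pin — not the caps — decide (`HOME/b2b-balaban-beta-d4-p2/g88/numerics/adaptive1.py`, `adaptive2.py`: the census four ages
# `{1,k₂} + {k₃} + {k₄}` close for EVERY `k₄∕k₃` once `k₃ ≥ 60k₂`, given pair caps by span that the argmax certificate of (E100e) delivers —
# needed `V(F) ≤ 0.78∕0.85∕0.90∕0.99∕1.06` at `F = 4∕6∕8∕12∕16` against certified `0.69∕0.71∕0.75∕0.81∕0.87`; the uniform engine cannot see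
# `2 < k₄∕k₃ < 61` at all).  This file is the pure engine: **`adaptive_cascade_level`** (§1, (E95c) §1 with level-dependent constants `C j'`) and
# **`renewal_nonneg_adaptive_cascade`** (§2: overshoots `κ j q ≥ 0` per level AND per pin, closures at every pin with the actual row masses
# `x j q`, levels only NESTED `hi j ≤ lo (j+1)`, `1 ≤ lo j`).  The flow instance and the census are the sequels (E101b–d).

Cell `pub-balaban`, β-function sub-cell, BINDER row D4 «RemainderConst leaves for Bałaban's split» (`HOME/BINDER-OWNERS.md`; owner lineage `b2b-balaban-beta-an4`;
this file by co-owner #2 lineage `b2b-balaban-beta-d4-p2`, generation 88), β-FLOW TEAM duty (1), FREEZE (0) honoured (def-free; Mathlib only; nothing restated).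
Sequel of (E95c) `…ClusterCascade` (the case `κ j q = κ` constant, separation `R₀·hi j ≤ lo (j+1)`); same abstract renewal language.

HONEST FRAMING (page 1, verbatim and binding).  *"Discharging BetaPertH makes Bałaban's UV stability UNCONDITIONAL — a real constructive-QFT result; it is
NOT the continuum limit and NOT the Clay problem."*  THIS FILE DISCHARGES NOTHING OF THE KIND.  Elementary real algebra about ABSTRACT real sequences and
triangular renewal systems — hypotheses of a census, not facts; the form, signs, ages and moments of Bałaban's (1.22) limit functional are NOT PRINTED
([I] p. 298; GAPS G-t4-U2-1∕-2) and NOT asserted.  Row D4 class UNCHANGED (critical-path width 0; instance 0∕1; D4 DISCHARGE NO DATE).  HONEST DEPENDENCY: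
continuum YM on T⁴ ⇐ BetaPertH ∧ nine spine estimates (0/9 proved); BetaPertH ⇐ (D1) ∧ (D4) ∧ CAP+tail; G-an2-4 gates asym, D1 and NE2/3/4.

THE POINT (README `HOME/b2b-balaban-beta-d4-p2/g88/README.md` §5).  With `B_j := e_m − Σ_{j'≥j} O^{j'}_m`, `C_j := 1 + κ_j`, `U_j := Σ_{j'>j} ν_{j'}C_{j'}B_{j'+1}`
the invariant «`B_{j'} ≥ 0`, targets of level `j'` `≤ C_{j'}B_{j'+1}` (`j' ≥ j`), `hi_{j−1}U_{j−1} ≤ κ_{j−1}B_j`» descends from `j = r` (where `U_{r−1} = 0`)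
to `j = 1`: targets of `j−1` `≤ B_j + hi_{j−1}U_{j−1} ≤ C_{j−1}B_j`; `B_{j−1} ≥ (1 − x_{j−1}C_{j−1})B_j`; and `lo_j·U_{j−1} = lo_jν_jC_jB_{j+1} + lo_jU_j ≤
(4x_jC_j + κ_j)B_{j+1}`, so `hi_{j−1}U_{j−1} ≤ κ_{j−1}(1 − x_jC_j)B_{j+1} ≤ κ_{j−1}B_j` by the closure.  NOT CLAIMED: any mass bound or flow instance (sequels);
anything nonlinear; anything printed — NOT B12 Thm 2, NOT BetaPertH, NOT continuum, NOT Clay.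

WHAT IS PROVED ([folklore]; 0 `def`, 0 sorry).  §1 **`adaptive_cascade_level`**.  §2 **`renewal_nonneg_adaptive_cascade`**.
-/
noncomputable section
open Finset

namespace Summit.QuantumFields.BalabanUV.Beta.EriceRemainderEnclosureHistoryAutonomyComparisonAgeCompositionAdaptiveCascade

/-! ## §1 One level of the adaptive cascade -/

/-- **ONE LEVEL OF THE ADAPTIVE CASCADE (pure, one pin `m`, one level `j`).**  As (E95c) `cluster_cascade_level` with LEVEL-DEPENDENT constants
`C j' ≥ 1`: reads `O j' q = Σ_{l<Kw} w j' q l·ε_{q+1+l}` (weights `≥ 0`, vanishing for `l ≥ hi j'`, row sums `≤ x_{j'}(q)`), `ε_q = e_q − Σ_{j'<r} O j' q`,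
`0 ≤ ε ≤ e` beyond `m`, `e` non-increasing, `hi j ≤ lo j'` for `j < j' < r`, relative variation `O j' m − O j' (m+d) ≤ ν_{j'}(m)·d·T` (`1 ≤ d ≤ lo j'`,
own targets `≤ T`).  With `B j' = e_m − Σ_{i∈[j',r)} O i m`: IF `B j' ≥ 0` (`j < j' ≤ r`), the targets of every older level `j'` are `≤ C j'·B (j'+1)`, and
`hi_j·Σ_{j'∈(j,r)} ν_{j'}(m)·C j'·B(j'+1) ≤ (C j − 1)·B (j+1)`, THEN the targets of level `j` are `≤ C j·B (j+1)` and `B j ≥ (1 − x_j(m)·C j)·B (j+1)`.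
[folklore] -/
theorem adaptive_cascade_level {r Kw m j : ℕ} {C : ℕ → ℝ} {lo hi : ℕ → ℕ} {w : ℕ → ℕ → ℕ → ℝ} {x ν O : ℕ → ℕ → ℝ} {e ε B : ℕ → ℝ}
    (hjr : j < r) (hC : ∀ j', 1 ≤ C j')
    (hw0 : ∀ j' q l, 0 ≤ w j' q l) (hwa : ∀ j' q l, hi j' ≤ l → w j' q l = 0) (hν0 : ∀ j' q, 0 ≤ ν j' q)
    (hrow : ∀ j' q, j' < r → ∑ l ∈ range Kw, w j' q l ≤ x j' q)
    (hO : ∀ j' q, O j' q = ∑ l ∈ range Kw, w j' q l * ε (q + 1 + l))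
    (hsep : ∀ j', j < j' → j' < r → hi j ≤ lo j')
    (hvar : ∀ j' d (T : ℝ), j < j' → j' < r → 1 ≤ d → d ≤ lo j' → 0 ≤ T → (∀ q, m < q → 0 ≤ ε q) →
      (∀ q, m < q → q ≤ m + hi j' → ε q ≤ T) → O j' m - O j' (m + d) ≤ ν j' m * d * T)
    (hea : ∀ q, e (q + 1) ≤ e q) (hrec : ∀ q, ε q = e q - ∑ i ∈ range r, O i q)
    (IH : ∀ q, m < q → 0 ≤ ε q ∧ ε q ≤ e q)
    (hB : ∀ j', B j' = e m - ∑ i ∈ Ico j' r, O i m)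
    (hBnn : ∀ j', j < j' → j' ≤ r → 0 ≤ B j')
    (hT : ∀ j', j < j' → j' < r → ∀ q, m < q → q ≤ m + hi j' → ε q ≤ C j' * B (j' + 1))
    (hU : (hi j : ℝ) * ∑ i ∈ Ico (j + 1) r, ν i m * (C i * B (i + 1)) ≤ (C j - 1) * B (j + 1)) :
    (∀ q, m < q → q ≤ m + hi j → ε q ≤ C j * B (j + 1)) ∧ (1 - x j m * C j) * B (j + 1) ≤ B j := by
  have hea' : ∀ p q, p ≤ q → e q ≤ e p := by
    intro p q hpq
    induction q, hpq using Nat.le_induction with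
    | base => exact le_rfl
    | succ q _ ih => exact (hea q).trans ih
  -- every read is non-negative at every pin `q ≥ m`
  have hOnn : ∀ i q, m ≤ q → 0 ≤ O i q := fun i q hq => by
    rw [hO]; exact sum_nonneg fun l _ => mul_nonneg (hw0 i q l) (IH _ (by omega)).1
  have hBj1 : 0 ≤ B (j + 1) := hBnn (j + 1) (by omega) (by omega)
  have hCj := hC j
  -- the targets of level `j` carry every older read, each of which has moved by ≤ ν·hi_j·C·B since the pin
  have htar : ∀ q, m < q → q ≤ m + hi j → ε q ≤ C j * B (j + 1) := by
    intro q hmq hqa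
    obtain ⟨d, rfl⟩ : ∃ d, q = m + d := ⟨q - m, by omega⟩
    have hd1 : 1 ≤ d := by omega
    have hda : d ≤ hi j := by omega
    have h1 : ε (m + d) ≤ e m - ∑ i ∈ Ico (j + 1) r, O i (m + d) := by
      rw [hrec (m + d)]
      have hsplit := (sum_range_add_sum_Ico (fun i => O i (m + d)) (show j + 1 ≤ r by omega)).symm
      have hlow : 0 ≤ ∑ i ∈ range (j + 1), O i (m + d) := sum_nonneg fun i _ => hOnn i (m + d) (by omega)
      have hem := hea' m (m + d) (by omega)
      rw [hsplit]; linarith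
    have h2 : ∑ i ∈ Ico (j + 1) r, (O i m - O i (m + d)) ≤ ∑ i ∈ Ico (j + 1) r, ν i m * (hi j : ℝ) * (C i * B (i + 1)) := by
      refine sum_le_sum fun i hi' => ?_
      have hi'' := mem_Ico.mp hi'
      have hdai : d ≤ lo i := hda.trans (hsep i (by omega) hi''.2)
      have hTnn : 0 ≤ C i * B (i + 1) := mul_nonneg (by linarith [hC i]) (hBnn (i + 1) (by omega) (by omega))
      have hv := hvar i d (C i * B (i + 1)) (by omega) hi''.2 hd1 hdai hTnn (fun q hq => (IH q hq).1) (hT i (by omega) hi''.2)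
      have hdr : (d : ℝ) ≤ hi j := by exact_mod_cast hda
      have h3 : ν i m * (d : ℝ) * (C i * B (i + 1)) ≤ ν i m * (hi j : ℝ) * (C i * B (i + 1)) :=
        mul_le_mul_of_nonneg_right (mul_le_mul_of_nonneg_left hdr (hν0 i m)) hTnn
      exact hv.trans h3
    have h3 : ∑ i ∈ Ico (j + 1) r, ν i m * (hi j : ℝ) * (C i * B (i + 1))
        = (hi j : ℝ) * ∑ i ∈ Ico (j + 1) r, ν i m * (C i * B (i + 1)) := by
      rw [mul_sum]; exact sum_congr rfl fun i _ => by ring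
    have h4 : ∑ i ∈ Ico (j + 1) r, O i (m + d) = ∑ i ∈ Ico (j + 1) r, O i m - ∑ i ∈ Ico (j + 1) r, (O i m - O i (m + d)) := by
      rw [← sum_sub_distrib]; exact sum_congr rfl fun i _ => by ring
    have hB1 := hB (j + 1)
    rw [h3] at h2
    rw [h4] at h1
    have : C j * B (j + 1) = B (j + 1) + (C j - 1) * B (j + 1) := by ring
    linarith [h1, h2, hU, hB1]
  refine ⟨htar, ?_⟩
  -- the peeling: O j m ≤ (row sum)·C_j·B(j+1) ≤ x_j(m)·C_j·B(j+1), and B j = B(j+1) − O j m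
  have hOj : O j m ≤ x j m * (C j * B (j + 1)) := by
    rw [hO]
    calc ∑ l ∈ range Kw, w j m l * ε (m + 1 + l) ≤ ∑ l ∈ range Kw, w j m l * (C j * B (j + 1)) := by
          refine sum_le_sum fun l _ => ?_
          by_cases hl : l < hi j
          · exact mul_le_mul_of_nonneg_left (htar (m + 1 + l) (by omega) (by omega)) (hw0 j m l)
          · rw [hwa j m l (not_lt.mp hl)]; simp
      _ = (∑ l ∈ range Kw, w j m l) * (C j * B (j + 1)) := by rw [sum_mul]
      _ ≤ x j m * (C j * B (j + 1)) := mul_le_mul_of_nonneg_right (hrow j m hjr) (mul_nonneg (by linarith) hBj1)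
  have hBj : B j = B (j + 1) - O j m := by
    rw [hB j, hB (j + 1), sum_eq_sum_Ico_succ_bot hjr]; ring
  rw [hBj]
  nlinarith [hOj]

/-! ## §2 The adaptive cascade: nested levels, per-level and per-pin overshoots -/

/-- **THE ADAPTIVE RESIDUAL CASCADE (pure).**  `ε_q = e_q − Σ_{j<r} O j q` at every pin, `ε = 0` beyond the horizon `N`, `e ≥ 0` non-increasing; the
read of level `j < r` is `O j q = Σ_{l<Kw} w j q l·ε_{q+1+l}` with non-negative weights vanishing for `l ≥ hi j` and row sums `≤ x_j(q)`;
levels `1 ≤ j < r` have a youngest age `1 ≤ lo j ≤ hi j` and a variation RATE `ν_j(q) ≥ 0` with `lo_j·ν_j(q) ≤ 4x_j(q)`; the levels are NESTED,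
`hi j ≤ lo (j+1)`; RELATIVE VARIATION for `j ≥ 1` as in (E95c).  OVERSHOOTS `κ j q ≥ 0` per level and per pin, with the ADAPTIVE CLOSURES at every pin:
`x_0(q)(1 + κ 0 q) ≤ 1` and, for `1 ≤ j < r`, `x_j(q)(1 + κ j q) < 1` and `hi (j−1)·(4x_j(q)(1 + κ j q) + κ j q) ≤ κ (j−1) q·(1 − x_j(q)(1 + κ j q))·lo j`.
THEN `0 ≤ ε ≤ e` at every pin — for every number of levels, whatever the masses; the top level may take `κ (r−1) q = 0`. [folklore] -/
theorem renewal_nonneg_adaptive_cascade {r N Kw : ℕ} {κ : ℕ → ℕ → ℝ} {lo hi : ℕ → ℕ} {w : ℕ → ℕ → ℕ → ℝ} {x ν O : ℕ → ℕ → ℝ} {e ε : ℕ → ℝ}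
    (hκ0 : ∀ j q, 0 ≤ κ j q)
    (hclose0 : ∀ q, x 0 q * (1 + κ 0 q) ≤ 1)
    (hclose : ∀ j q, 1 ≤ j → j < r → x j q * (1 + κ j q) < 1 ∧
      (hi (j - 1) : ℝ) * (4 * x j q * (1 + κ j q) + κ j q) ≤ κ (j - 1) q * (1 - x j q * (1 + κ j q)) * lo j)
    (hnest : ∀ j, j + 1 < r → hi j ≤ lo (j + 1)) (hlohi : ∀ j, 1 ≤ j → j < r → lo j ≤ hi j) (hlo1 : ∀ j, 1 ≤ j → j < r → 1 ≤ lo j)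
    (hw0 : ∀ j q l, 0 ≤ w j q l) (hwa : ∀ j q l, hi j ≤ l → w j q l = 0) (hν0 : ∀ j q, 0 ≤ ν j q)
    (hrow : ∀ j q, j < r → ∑ l ∈ range Kw, w j q l ≤ x j q)
    (hνx : ∀ j q, 1 ≤ j → j < r → (lo j : ℝ) * ν j q ≤ 4 * x j q)
    (hO : ∀ j q, O j q = ∑ l ∈ range Kw, w j q l * ε (q + 1 + l))
    (hvar : ∀ j m d (T : ℝ), 1 ≤ j → j < r → 1 ≤ d → d ≤ lo j → 0 ≤ T → (∀ q, m < q → 0 ≤ ε q) →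
      (∀ q, m < q → q ≤ m + hi j → ε q ≤ T) → O j m - O j (m + d) ≤ ν j m * d * T)
    (he0 : ∀ q, 0 ≤ e q) (hea : ∀ q, e (q + 1) ≤ e q)
    (hεt : ∀ q, N < q → ε q = 0) (hrec : ∀ q, ε q = e q - ∑ j ∈ range r, O j q) : ∀ m, 0 ≤ ε m ∧ ε m ≤ e m := by
  -- downward induction from the horizon: it suffices to do one pin given the bounds beyond it
  suffices step : ∀ m, (∀ q, m < q → 0 ≤ ε q ∧ ε q ≤ e q) → 0 ≤ ε m ∧ ε m ≤ e m by
    have main : ∀ n m, N < m + n → 0 ≤ ε m ∧ ε m ≤ e m := by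
      intro n
      induction n with
      | zero => intro m hm; rw [hεt m (by omega)]; exact ⟨le_rfl, he0 m⟩
      | succ n ih => intro m hm; exact step m fun q hq => ih q (by omega)
    exact fun m => main (N + 1) m (by omega)
  intro m IH
  have hOnn : ∀ i q, m ≤ q → 0 ≤ O i q := fun i q hq => by
    rw [hO]; exact sum_nonneg fun l _ => mul_nonneg (hw0 i q l) (IH _ (by omega)).1
  have hsum0 : 0 ≤ ∑ j ∈ range r, O j m := sum_nonneg fun j _ => hOnn j m le_rfl
  refine ⟨?_, by rw [hrec m]; linarith⟩
  -- the constants at this pin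
  obtain ⟨C, hC⟩ : ∃ C : ℕ → ℝ, ∀ j, C j = 1 + κ j m := ⟨_, fun _ => rfl⟩
  have hC1 : ∀ j, 1 ≤ C j := fun j => by rw [hC]; linarith [hκ0 j m]
  -- the windows of the younger levels fit under the youngest ages of the older ones
  have hhilo : ∀ j j', j < j' → j' < r → hi j ≤ lo j' := by
    intro j j' hjj' hj'r
    induction j', hjj' using Nat.le_induction with
    | base => exact hnest j hj'r
    | succ j' hle ih =>
      have h1 := ih (by omega)
      have h2 := hnest j' hj'r
      have h3 := hlohi j' (by omega) (by omega)
      omega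
  -- the residuals and the variation rates (opaque names with defining equations)
  obtain ⟨B, hB⟩ : ∃ B : ℕ → ℝ, ∀ j, B j = e m - ∑ i ∈ Ico j r, O i m := ⟨_, fun _ => rfl⟩
  obtain ⟨U, hU⟩ : ∃ U : ℕ → ℝ, ∀ j, U j = ∑ i ∈ Ico (j + 1) r, ν i m * (C i * B (i + 1)) := ⟨_, fun _ => rfl⟩
  have hBr : B r = e m := by rw [hB, Ico_self, sum_empty, sub_zero]
  have hB0 : B 0 = ε m := by rw [hB, hrec m, range_eq_Ico]
  -- the case of no level at all
  rcases Nat.eq_zero_or_pos r with hr0 | hrpos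
  · rw [hr0] at hBr; rw [← hB0, hBr]; exact he0 m
  -- one level, packaged
  have level : ∀ j, j < r → (∀ j', j < j' → j' ≤ r → 0 ≤ B j') →
      (∀ j', j < j' → j' < r → ∀ q, m < q → q ≤ m + hi j' → ε q ≤ C j' * B (j' + 1)) →
      (hi j : ℝ) * U j ≤ κ j m * B (j + 1) →
      (∀ q, m < q → q ≤ m + hi j → ε q ≤ C j * B (j + 1)) ∧ (1 - x j m * C j) * B (j + 1) ≤ B j := by
    intro j hjr hBnn hT hUj
    have hU' : (hi j : ℝ) * ∑ i ∈ Ico (j + 1) r, ν i m * (C i * B (i + 1)) ≤ (C j - 1) * B (j + 1) := by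
      rw [← hU j, hC j]; linarith
    exact adaptive_cascade_level hjr hC1 hw0 hwa hν0 hrow hO (fun j' hjj' hj'r => hhilo j j' hjj' hj'r)
      (fun j' d T hjj' hj'r => hvar j' m d T (by omega) hj'r) hea hrec IH hB hBnn hT hU'
  -- THE DESCENT from j = r to j = 1
  have main : ∀ n j, j + n = r → 1 ≤ j →
      (∀ j', j ≤ j' → j' ≤ r → 0 ≤ B j') ∧
      (∀ j', j ≤ j' → j' < r → ∀ q, m < q → q ≤ m + hi j' → ε q ≤ C j' * B (j' + 1)) ∧
      ((hi (j - 1) : ℝ) * U (j - 1) ≤ κ (j - 1) m * B j) := by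
    intro n
    induction n with
    | zero =>
      intro j hj hj1
      rw [add_zero] at hj
      subst hj
      refine ⟨fun j' h1 h2 => ?_, fun j' h1 h2 => absurd h2 (not_lt.mpr h1), ?_⟩
      · rw [show j' = j from le_antisymm h2 h1, hBr]; exact he0 m
      · rw [hU, show j - 1 + 1 = j from Nat.sub_add_cancel hj1, Ico_self, sum_empty, mul_zero, hBr]
        exact mul_nonneg (hκ0 _ m) (he0 m)
    | succ n ih =>
      intro j hj hj1
      obtain ⟨hBnn, hT, hUj⟩ := ih (j + 1) (by omega) (by omega)
      have hjr : j < r := by omega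
      rw [Nat.add_sub_cancel] at hUj
      obtain ⟨htar, hpeel⟩ := level j hjr (fun j' h1 h2 => hBnn j' (by omega) h2) (fun j' h1 h2 => hT j' (by omega) h2) hUj
      have hBj1 : 0 ≤ B (j + 1) := hBnn (j + 1) le_rfl (by omega)
      -- the closure at level j ≥ 1: x_j C_j < 1, so B j ≥ (1 − x_jC_j) B(j+1) ≥ 0
      obtain ⟨hxC, hcl⟩ := hclose j m hj1 hjr
      rw [← hC j] at hxC hcl
      have hlamj : 0 < 1 - x j m * C j := by linarith
      have hBj : (1 - x j m * C j) * B (j + 1) ≤ B j := hpeel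
      have hBj0 : 0 ≤ B j := le_trans (mul_nonneg hlamj.le hBj1) hBj
      refine ⟨fun j' h1 h2 => ?_, fun j' h1 h2 => ?_, ?_⟩
      · by_cases hj' : j' = j
        · rw [hj']; exact hBj0
        · exact hBnn j' (by omega) h2
      · by_cases hj' : j' = j
        · subst hj'; exact htar
        · exact hT j' (by omega) h2
      · -- one level down: lo_j·U_{j−1} = (lo_jν_j)C_jB(j+1) + lo_jU_j ≤ (4x_jC_j + κ_j)B(j+1); times hi_{j−1}, the closure, and B j ≥ (1 − x_jC_j)B(j+1)
        have hUsplit : U (j - 1) = ν j m * (C j * B (j + 1)) + U j := by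
          rw [hU (j - 1), hU j, Nat.sub_add_cancel hj1, sum_eq_sum_Ico_succ_bot hjr]
        have hlh : (lo j : ℝ) ≤ hi j := by exact_mod_cast hlohi j hj1 hjr
        have hlo0 : (0 : ℝ) < lo j := by exact_mod_cast hlo1 j hj1 hjr
        have hC0 : (0 : ℝ) ≤ C j := by linarith [hC1 j]
        have hUj0 : 0 ≤ U j := by
          rw [hU j]
          exact sum_nonneg fun i hi' => mul_nonneg (hν0 i m)
            (mul_nonneg (by linarith [hC1 i]) (hBnn (i + 1) (by have := (mem_Ico.mp hi').1; omega) (by have := (mem_Ico.mp hi').2; omega)))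
        have hU0 : 0 ≤ U (j - 1) := by
          rw [hUsplit]; exact add_nonneg (mul_nonneg (hν0 j m) (mul_nonneg hC0 hBj1)) hUj0
        have h1 : (lo j : ℝ) * U (j - 1) ≤ (4 * x j m * C j + κ j m) * B (j + 1) := by
          have hνx' := hνx j m hj1 hjr
          have hCB : 0 ≤ C j * B (j + 1) := mul_nonneg hC0 hBj1
          calc (lo j : ℝ) * U (j - 1) = ((lo j : ℝ) * ν j m) * (C j * B (j + 1)) + (lo j : ℝ) * U j := by rw [hUsplit]; ring
            _ ≤ 4 * x j m * (C j * B (j + 1)) + (hi j : ℝ) * U j :=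
                add_le_add (mul_le_mul_of_nonneg_right hνx' hCB) (mul_le_mul_of_nonneg_right hlh hUj0)
            _ ≤ 4 * x j m * (C j * B (j + 1)) + κ j m * B (j + 1) := by linarith
            _ = (4 * x j m * C j + κ j m) * B (j + 1) := by ring
        have h2 : (hi (j - 1) : ℝ) * U (j - 1) * lo j ≤ κ (j - 1) m * B j * lo j := by
          calc (hi (j - 1) : ℝ) * U (j - 1) * lo j = (hi (j - 1) : ℝ) * ((lo j : ℝ) * U (j - 1)) := by ring
            _ ≤ (hi (j - 1) : ℝ) * ((4 * x j m * C j + κ j m) * B (j + 1)) := mul_le_mul_of_nonneg_left h1 (Nat.cast_nonneg _)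
            _ = (hi (j - 1) : ℝ) * (4 * x j m * C j + κ j m) * B (j + 1) := by ring
            _ ≤ κ (j - 1) m * (1 - x j m * C j) * lo j * B (j + 1) := mul_le_mul_of_nonneg_right hcl hBj1
            _ = κ (j - 1) m * lo j * ((1 - x j m * C j) * B (j + 1)) := by ring
            _ ≤ κ (j - 1) m * lo j * B j := mul_le_mul_of_nonneg_left hBj (mul_nonneg (hκ0 _ m) hlo0.le)
            _ = κ (j - 1) m * B j * lo j := by ring
        exact le_of_mul_le_mul_right h2 hlo0
  -- THE LAST LEVEL: the youngest cluster needs only x₀ C₀ ≤ 1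
  obtain ⟨hBnn, hT, hU0⟩ := main (r - 1) 1 (by omega) le_rfl
  rw [Nat.sub_self] at hU0
  obtain ⟨-, hpeel⟩ := level 0 hrpos (fun j' h1 h2 => hBnn j' (by omega) h2) (fun j' h1 h2 => hT j' (by omega) h2) hU0
  have hB1 : 0 ≤ B 1 := hBnn 1 le_rfl (by omega)
  have h1 : 0 ≤ 1 - x 0 m * C 0 := by rw [hC 0]; linarith [hclose0 m]
  rw [← hB0]
  exact le_trans (mul_nonneg h1 hB1) hpeel

end Summit.QuantumFields.BalabanUV.Beta.EriceRemainderEnclosureHistoryAutonomyComparisonAgeCompositionAdaptiveCascade
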